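import Summits.CriticalPhenomena.PercolationContinuityZ3.Theorems.Transplant.SkelRootSeedLaw
import Summits.CriticalPhenomena.PercolationContinuityZ3.Theorems.Transplant.SkelPhiConcExcess
import Summits.CriticalPhenomena.PercolationContinuityZ3.Theorems.Transplant.SkelPhiWinChainF
import HarnessLib

/-!
# N1 (the `{±1}` node), (R) column (N1-R-PLAN v2 §4 (R4e); NEG-SCOPE B.12 (D7)): THE RIM EXCESS OF THE ROOT CHAIN UNDER THE ROOT-SEED LAW —
# `Skelφ.rootRim` (the far part `∉ B_G(t, Rπ − L′)` of a step region window) and **`Skelφ.real_rootRim_le`**: for a step region `D_k ⊆ U'` off the pinned seed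
# `A ⊆ B_G(t, ρ)`, under `W0pin (edgesIn G A) U'` the root is joined to the rim with probability `≤ η`, from an excess radius `R₁ ≤ Rπ − L′` at the running
# density (`hR₁`, the conclusion of `Skelφ.exists_excess_radius_uniform` at entrance depth `ρ + 1`) and the planar diameter `m` of the cut root world

D″ pattern (`Skelφ.real_rim_le_schedSG`, SkelPhiRootSched): the honest set is `D := U' ∖ A` (there: `U' ∖ Q₀`), every entrance of `D` from the pinned side is a neighbour of
the seed, hence of depth `≤ ρ + 1`; then `Skelφ.real_rim_le_of_radius`.  The planar diameter is measured in the SKELETON map `φ` whose cylinders are subcritical (Φ2).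
builds on p205010 (kernel theorem, internal audit signed; external expert review pending) — nothing in this file uses p205010; nothing here is a claim about the open node.
Lane `prim-bschramm`, seat `prim-bschramm-p3` (gen 9; design owner + (R) owner); helper file (`--supports stmt-CriticalPhenomena-4575 --as helper`).
[cite: KozmaNitzan2024, §4 Lemma 12 (p. 24: the excess), p. 28 ((32) at the root)] [cite: MartineauSevero2019, Cor. 2.2]
-/

noncomputable section

open MeasureTheory

namespace Summit.CriticalPhenomena.PercolationContinuityZ3.Theorems

namespace Transplant

namespace Skelφ

open Literature.Probability.Percolation Literature.Probability.LatticeModels SimpleGraph KNLevels KNCells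
open Literature.Barriers.CriticalPhenomena (graphBall mem_graphBall_self graphBall_mono)
open Skel (excess winGraph isSubbox_W0pin_win)

open scoped Classical

variable {V : Type} [DecidableEq V] [Countable V] {G : SimpleGraph V} [G.LocallyFinite] {φ : V → Site 2} {A' : Type*}

/-- **The rim of a step region window**: its vertices beyond graph radius `Rπ − L′` from the root. [cite: KozmaNitzan2024, §4 p. 20 (Step IV), Lemma 12] -/
def rootRim (t : V) (Rπ L' : ℕ) (Dk : Finset V) : Finset V := Dk.filter fun v => v ∉ graphBall G t (Rπ - L')

omit [DecidableEq V] [Countable V] [G.LocallyFinite] in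
/-- The rim lies in its region. [folklore] -/
theorem rootRim_subset (t : V) (Rπ L' : ℕ) (Dk : Finset V) : rootRim (G := G) t Rπ L' Dk ⊆ Dk := Finset.filter_subset _ _

/-- **RIM EXCESS `≤ η` UNDER THE ROOT-SEED LAW.**  Scheme `S`, root `t` (the source), direction `du`, cut world `U' = U0root du ∩ B(t, Rπ)`, pinned seed `A ⊆ B(t, ρ)` with `t ∈ A`;
a region `Dk ⊆ U'` disjoint from `A`; an excess radius `R₁ ≤ Rπ − L′` at `S.p` for entrance depth `ρ + 1` and planar diameter `m` (in `φ`) of `U' ∖ A`.  Then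
`P_{W0pin (edgesIn A) U'}(⋃_{v ∈ rim} t ↔ v) ≤ η`. [cite: KozmaNitzan2024, §4 Lemma 12 (p. 24)] [cite: MartineauSevero2019, Cor. 2.2] -/
theorem real_rootRim_le {S : KSchA V A'} {du : MDir} {t : V} {Rπ L' ρ : ℕ}
    {A : Finset V} (htA : t ∈ A) (hAρ : ∀ a ∈ A, a ∈ graphBall G t ρ)
    {Dk : Finset V} (hDU : Dk ⊆ (S.U0root du).filter fun y => y ∈ graphBall G t Rπ) (hDA : Disjoint Dk A)
    {m : ℕ} {η : ℝ} {R₁ : ℕ}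
    (hR₁ : ∀ R', R₁ ≤ R' → ∀ (Rw : ℕ) (D' B' : Finset V), (∀ d ∈ D', d ∈ graphBall G t Rw) →
      (∀ d ∈ D', ∀ d' ∈ D', φ d - φ d' ∈ box 2 m) → B' ⊆ D' → (∀ a ∈ B', a ∈ graphBall G t (ρ + 1)) →
        (bondPercolation G S.p).real (excess G t R' D' B') ≤ η)
    (hR : R₁ ≤ Rπ - L')
    (hDm : ∀ d ∈ ((S.U0root du).filter fun y => y ∈ graphBall G t Rπ) \ A, ∀ d' ∈ ((S.U0root du).filter fun y => y ∈ graphBall G t Rπ) \ A, φ d - φ d' ∈ box 2 m) :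
    (prodBernoulli (S.W0pin G (edgesIn G A) ((S.U0root du).filter fun y => y ∈ graphBall G t Rπ))).real
      (⋃ v ∈ rootRim (G := G) t Rπ L' Dk, openConn t v) ≤ η := by
  set U' : Finset V := (S.U0root du).filter fun y => y ∈ graphBall G t Rπ with hU'
  set F : Finset (Sym2 V) := edgesIn G A with hF
  set W : Sym2 V → unitInterval := S.W0pin G F U' with hW
  set D : Finset V := U' \ A with hD
  have hFA : ∀ e ∈ F, ∀ w ∈ e, w ∈ A := fun e he w hw => ((mem_edgesIn_iff).1 he).2 w hw
  have hFG : ∀ e ∈ F, e ∈ G.edgeSet := fun e he => ((mem_edgesIn_iff).1 he).1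
  -- the honest set `U' ∖ A` is a subbox of the window graph, inside the ball, off the root
  have hDsub : D ⊆ U' := Finset.sdiff_subset
  have hWD : IsSubbox (winGraph G t Rπ) W S.p D :=
    isSubbox_W0pin_win (S := S) t Rπ (U := S.U0root du) hDsub (KSchA.fresh_of_disjoint hFA Finset.sdiff_disjoint)
  have hDπ : ∀ v ∈ D, v ∈ graphBall G t Rπ := fun v hv => (Finset.mem_filter.1 (hDsub hv)).2
  have hWG : ∀ e, e ∉ G.edgeSet → W e = 0 := fun e he => KSchA.W0pin_eq_zero_of_not_mem_edgeSet hFG U' he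
  have htD : t ∉ D := fun h' => (Finset.mem_sdiff.1 h').2 htA
  have hRimD : rootRim (G := G) t Rπ L' Dk ⊆ D := fun v hv =>
    Finset.mem_sdiff.2 ⟨hDU (rootRim_subset (G := G) t Rπ L' Dk hv), Finset.disjoint_left.1 hDA (rootRim_subset (G := G) t Rπ L' Dk hv)⟩
  have hRimfar : ∀ v ∈ rootRim (G := G) t Rπ L' Dk, v ∉ graphBall G t (Rπ - L') := fun v hv => (Finset.mem_filter.1 hv).2
  -- every entrance of `D` from outside with positive weight comes from the seed, hence lands at depth `≤ ρ + 1`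
  have hA : ∀ a b, a ∉ D → b ∈ D → G.Adj a b → W s(a, b) ≠ 0 → b ∈ graphBall G t (ρ + 1) := by
    intro a b ha hb hadj hw
    have haU : a ∈ U' := by
      by_contra haU
      apply hw
      change restrW (↑U' : Set V) (pinW (KNLevels.lattW G S.p) ↑F ↑F) s(a, b) = 0
      exact restrW_apply_of_not_mem _ (fun h' => haU (Finset.mem_coe.1 (h'.1 a (Sym2.mem_mk_left _ _))))
    have haA : a ∈ A := by
      by_contra haA
      exact ha (Finset.mem_sdiff.2 ⟨haU, haA⟩)
    exact BoxProdZ2.mem_graphBall_succ_of_adj G (hAρ a haA) hadj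
  exact real_rim_le_of_radius (φ := φ) (q := S.p) hWD hDπ hWG htD hRimD hRimfar hA hR₁ hR (Rw := Rπ) hDπ hDm

end Skelφ

end Transplant

end Summit.CriticalPhenomena.PercolationContinuityZ3.Theorems

end
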